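import Summits.HubbardSuperconductivity.HubbardSuperconductivity.Theorems.LevyLogBootstrapBlock2InfDivXXZStubTransverseKernelPos
import Literature.MathematicalPhysics.QuantumLattice.HeisenbergOrderTranslationProofs
import HarnessLib

/-!
# Crux `Block2InfDivXXZ` (stmt-HubbardSuperconductivity-15048, route `LevyLogBootstrap`):
# translation covariance and symmetry of the ground-state transverse kernel

Support lemmas (no statement item is closed here) for the crux `Block2InfDivXXZ` — infinite
divisibility of the 2×2-block transverse kernel of the `S^z_tot = 0` sector ground state `ψ` of
`H_M(Δ) = xxzHamiltonian 1 (torusGraph 2 M) (-1) Δ` — and for its open stub `stub_blockLogNegType`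
(skeleton `Cruxes/Block2InfDivXXZ/Lines/birth.lean`). Every line towards the stub reasons about the
LÉVY COEFFICIENTS of the block kernel on the COARSE torus, which presupposes that the raw kernel
`K_ψ(x, y) = ⟨ψ, S⁺_x S⁻_y ψ⟩` is a symmetric function of `x - y` alone. This file proves exactly that:

* `xxzTorus_submatrix_comp_addRight` — `H_M(Δ)` (any spin, any `J`, `Δ`) is invariant under the
  relabelling of tensor indices `σ ↦ σ ∘ (· + v)` induced by a torus translation;
* `gs_expect_raiseLower_translate` — for every normalised `S^z_tot = 0` sector ground state `ψ`
  (even `M`): `⟨ψ, S⁺_{x+v} S⁻_{y+v} ψ⟩ = ⟨ψ, S⁺_x S⁻_y ψ⟩`. Proof: the translated vector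
  `ψ ∘ τ_v` is again a normalised sector ground state, hence a PHASE multiple of `ψ` by the
  Perron–Frobenius uniqueness of the sector ground state (`xxz_sector_perronFrobenius`, landed with
  route `PolyaSchurPairBoson`), and `S⁺_{x+v} S⁻_{y+v}` is the relabelling of `S⁺_x S⁻_y`;
* `conj_expect_raiseLower` — `conj ⟨ψ, S⁺_x S⁻_y ψ⟩ = ⟨ψ, S⁺_y S⁻_x ψ⟩` for every vector `ψ`
  (`(S⁺_x S⁻_y)† = S⁺_y S⁻_x`), so the real kernel `Re ⟨ψ, S⁺_x S⁻_y ψ⟩` is symmetric.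

Sources: H. Tasaki, *Physics and Mathematics of Quantum Many-Body Systems* (2020) §2.1–2.2
(covariance of local operators under lattice symmetries), §2.4 (Perron–Frobenius / Marshall in a
magnetisation sector); T. Kennedy, E. H. Lieb, B. S. Shastry, J. Stat. Phys. 53 (1988) 1019, p. 1021
(periodic boundary conditions, translation-averaged two-point functions). No definition is
introduced; sorry-free.
-/

noncomputable section

set_option linter.dupNamespace false

namespace Summit.HubbardSuperconductivity.HubbardSuperconductivity.Theorems.LevyLogBootstrap

open scoped BigOperators Matrix ComplexOrder ComplexConjugate
open Matrix Finset Complex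
open Literature.MathematicalPhysics.QuantumLattice Literature.Probability.LatticeModels
open Summit.AtomisticToContinuum.BoseEinsteinCondensation.Theorems.BECStronglyRayleighSectorPerron
open Summit.AtomisticToContinuum.BoseEinsteinCondensation.Theorems.InsertionFieldDelocalisation.Negative
open Summit.HubbardSuperconductivity.HubbardSuperconductivity.Theorems.PolyaSchurPairBoson

/-! ### Relabelling tensor indices along a site permutation: vectors and expectations -/

section Relabel

variable {Λ : Type*} [Fintype Λ] [DecidableEq Λ] {q : ℕ}

/-- If an operator `H` is invariant under the relabelling `σ ↦ σ ∘ π` of tensor indices, then it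
commutes with the relabelling of vectors: `H (ψ ∘ π̃) = (H ψ) ∘ π̃`, `π̃ σ = σ ∘ π`.
Tasaki (2020) §2.1 (symmetry operators). [folklore] -/
theorem mulVec_comp_of_submatrix_eq (π : Λ ≃ Λ) {H : Op Λ q}
    (hinv : H.submatrix (fun σ => σ ∘ π) (fun σ => σ ∘ π) = H) (ψ : TensorIndex Λ q → ℂ) :
    H *ᵥ (fun σ => ψ (σ ∘ π)) = fun σ => (H *ᵥ ψ) (σ ∘ π) := by
  funext σ
  simp only [mulVec, dotProduct]
  have hH : ∀ τ : TensorIndex Λ q, H σ τ = H (σ ∘ π) (τ ∘ π) := fun τ => by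
    conv_lhs => rw [← hinv]
    rfl
  simp_rw [hH]
  exact Fintype.sum_bijective _ (bijective_comp_equiv (q := q) π) _ _ fun τ => rfl

/-- A relabelled operator acts on relabelled vectors by the relabelled image:
`(A ∘ (π̃ × π̃)) (ψ ∘ π̃) = (A ψ) ∘ π̃`. Tasaki (2020) §2.1. [folklore] -/
theorem submatrix_comp_mulVec_comp (π : Λ ≃ Λ) (A : Op Λ q) (ψ : TensorIndex Λ q → ℂ) :
    A.submatrix (fun σ => σ ∘ π) (fun σ => σ ∘ π) *ᵥ (fun σ => ψ (σ ∘ π)) =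
      fun σ => (A *ᵥ ψ) (σ ∘ π) := by
  funext σ
  simp only [mulVec, dotProduct, submatrix_apply]
  exact Fintype.sum_bijective _ (bijective_comp_equiv (q := q) π) _ _ fun τ => rfl

/-- Relabelling tensor indices preserves inner products: `⟨ψ ∘ π̃, φ ∘ π̃⟩ = ⟨ψ, φ⟩`. [folklore] -/
theorem star_comp_dotProduct_comp (π : Λ ≃ Λ) (ψ φ : TensorIndex Λ q → ℂ) :
    star (fun σ => ψ (σ ∘ π)) ⬝ᵥ (fun σ => φ (σ ∘ π)) = star ψ ⬝ᵥ φ := by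
  simp only [dotProduct, Pi.star_apply]
  exact Fintype.sum_bijective _ (bijective_comp_equiv (q := q) π) _ _ fun τ => rfl

/-- Expectations are covariant: `⟨ψ ∘ π̃, (A ∘ (π̃ × π̃)) (ψ ∘ π̃)⟩ = ⟨ψ, A ψ⟩`.
Tasaki (2020) §2.1. [folklore] -/
theorem expect_submatrix_comp (π : Λ ≃ Λ) (A : Op Λ q) (ψ : TensorIndex Λ q → ℂ) :
    star (fun σ => ψ (σ ∘ π)) ⬝ᵥ
        (A.submatrix (fun σ => σ ∘ π) (fun σ => σ ∘ π) *ᵥ fun σ => ψ (σ ∘ π)) =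
      star ψ ⬝ᵥ (A *ᵥ ψ) := by
  rw [submatrix_comp_mulVec_comp]
  exact star_comp_dotProduct_comp π ψ (A *ᵥ ψ)

omit [DecidableEq Λ] in
/-- The weight `Σ_z σ_z` of a basis configuration is invariant under relabelling the sites. [folklore] -/
theorem weight_comp_equiv (π : Λ ≃ Λ) (σ : TensorIndex Λ q) :
    (∑ z, ((σ ∘ π) z : ℕ)) = ∑ z, (σ z : ℕ) :=
  Equiv.sum_comp π fun z => (σ z : ℕ)

/-- The conjugate of a transverse expectation: `conj ⟨ψ, S⁺_x S⁻_y ψ⟩ = ⟨ψ, S⁺_y S⁻_x ψ⟩` for every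
vector `ψ`, since `(S⁺_x S⁻_y)† = S⁺_y S⁻_x` (`S⁻ = (S⁺)†`, `onSite` is a `*`-map). In particular
the real kernel `Re ⟨ψ, S⁺_x S⁻_y ψ⟩` is symmetric in `(x, y)`. Tasaki (2020) §2.2. [folklore] -/
theorem conj_expect_raiseLower (n : ℕ) (ψ : TensorIndex Λ (n + 1) → ℂ) (x y : Λ) :
    conj (star ψ ⬝ᵥ (onSite x (spinRaise n) * onSite y (spinLower n)) *ᵥ ψ) =
      star ψ ⬝ᵥ (onSite y (spinRaise n) * onSite x (spinLower n)) *ᵥ ψ := by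
  have hadj : (onSite x (spinRaise n) * onSite y (spinLower n) : Op Λ (n + 1))ᴴ =
      onSite y (spinRaise n) * onSite x (spinLower n) := by
    rw [conjTranspose_mul, ← onSite_conjTranspose, ← onSite_conjTranspose,
      spinLower_eq_conjTranspose, conjTranspose_conjTranspose]
  rw [← Complex.star_def, star_dotProduct, star_star, star_mulVec, ← dotProduct_mulVec, hadj]

/-- Symmetry of the real transverse kernel: `Re ⟨ψ, S⁺_x S⁻_y ψ⟩ = Re ⟨ψ, S⁺_y S⁻_x ψ⟩` for every
vector `ψ`. [folklore] -/
theorem re_expect_raiseLower_symm (n : ℕ) (ψ : TensorIndex Λ (n + 1) → ℂ) (x y : Λ) :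
    (star ψ ⬝ᵥ (onSite x (spinRaise n) * onSite y (spinLower n)) *ᵥ ψ).re =
      (star ψ ⬝ᵥ (onSite y (spinRaise n) * onSite x (spinLower n)) *ᵥ ψ).re := by
  rw [← conj_expect_raiseLower, Complex.conj_re]

end Relabel

/-! ### Translation invariance of the XXZ torus Hamiltonian and of the sector ground state -/

section Torus

variable (M : ℕ) [NeZero M]

/-- **The XXZ Hamiltonian of the torus is translation invariant**: relabelling the sites by
`x ↦ x + v` (tensor indices by `σ ↦ σ ∘ (· + v)`) fixes `xxzHamiltonian n (torusGraph 2 M) J Δ`,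
because the translation permutes the bonds of the torus and maps each bond term to the bond term of
the image bond. Kennedy–Lieb–Shastry (1988), p. 1021; Tasaki (2020) §2.1. [folklore] -/
theorem xxzTorus_submatrix_comp_addRight (n : ℕ) (J Δ : ℝ) (v : TorusSite 2 M) :
    (xxzHamiltonian n (torusGraph 2 M) J Δ).submatrix
        (fun σ : TensorIndex (TorusSite 2 M) (n + 1) => σ ∘ Equiv.addRight v)
        (fun σ => σ ∘ Equiv.addRight v) =
      xxzHamiltonian n (torusGraph 2 M) J Δ := by
  simp only [xxzHamiltonian, submatrix_smul, Pi.smul_apply, submatrix_finset_sum]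
  congr 1
  refine Finset.sum_nbij' (Sym2.map (Equiv.addRight v)) (Sym2.map (Equiv.addRight v).symm)
    (fun e he => ?_) (fun e he => ?_) (fun e _ => ?_) (fun e _ => ?_) (fun e _ => ?_)
  · exact (sym2Map_addRight_mem_edgeFinset_torusGraph M v e).2 he
  · rw [Equiv.addRight_symm]
    exact (sym2Map_addRight_mem_edgeFinset_torusGraph M (-v) e).2 he
  · simp only [Sym2.map_map, Equiv.symm_comp_self, Sym2.map_id', id_eq]
  · simp only [Sym2.map_map, Equiv.self_comp_symm, Sym2.map_id', id_eq]
  · induction e using Sym2.ind with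
    | h x y =>
      simp only [Sym2.map_mk, Sym2.lift_mk, submatrix_add, submatrix_smul, Pi.add_apply,
        Pi.smul_apply, spinBond_submatrix_comp]

/-- **Translated sector ground states are phase multiples of themselves, so their expectations are
translation covariant.** For even `M`, every real `Δ` and every normalised `S^z_tot = 0` sector
ground state `ψ` of `H_M(Δ) = xxzHamiltonian 1 (torusGraph 2 M) (-1) Δ`:
`⟨ψ, S⁺_{x+v} S⁻_{y+v} ψ⟩ = ⟨ψ, S⁺_x S⁻_y ψ⟩` for all sites `x, y` and translations `v`.
Proof: `ψ ∘ τ_v` (`τ_v σ = σ ∘ (· + v)`) lies in the same sector (weights are relabelling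
invariant), has norm one and satisfies the same eigen-equation (`H_M(Δ)` is translation invariant,
`xxzTorus_submatrix_comp_addRight`), so by the Perron–Frobenius uniqueness of the sector ground
state (`xxz_sector_perronFrobenius`) `ψ ∘ τ_v = c ψ` with `|c| = 1`; and
`⟨ψ ∘ τ_v, S⁺_{x+v} S⁻_{y+v} (ψ ∘ τ_v)⟩ = ⟨ψ, S⁺_x S⁻_y ψ⟩` by covariance of `onSite`.
Tasaki (2020) §2.1, §2.4; Kennedy–Lieb–Shastry (1988) p. 1021. [folklore] -/
theorem gs_expect_raiseLower_translate (hEven : Even M) (Δ : ℝ)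
    (ψ : TensorIndex (TorusSite 2 M) 2 → ℂ)
    (hψ : ψ ∈ @spinZSector (TorusSite 2 M) _ _ 1 0) (hnorm : star ψ ⬝ᵥ ψ = 1)
    (heig : Matrix.mulVec (xxzHamiltonian 1 (torusGraph 2 M) (-1) Δ) ψ =
      ((lowestEnergyInSector 1 (xxzHamiltonian 1 (torusGraph 2 M) (-1) Δ) 0 : ℝ) : ℂ) • ψ)
    (v x y : TorusSite 2 M) :
    star ψ ⬝ᵥ (onSite (x + v) (spinRaise 1) * onSite (y + v) (spinLower 1)) *ᵥ ψ =
      star ψ ⬝ᵥ (onSite x (spinRaise 1) * onSite y (spinLower 1)) *ᵥ ψ := by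
  obtain ⟨k, hk⟩ := hEven
  set W : ℕ := 2 * k * k with hWdef
  have hM2 : M ^ 2 = 4 * k * k := by rw [hk]; ring
  have hWle : W ≤ M ^ 2 := by rw [hM2, hWdef]; nlinarith
  have hsecR : ((Fintype.card (TorusSite 2 M) * 1 : ℕ) : ℝ) / 2 - (W : ℝ) = 0 := by
    rw [card_torusSite, hWdef, hk]
    push_cast
    ring
  set H := xxzHamiltonian 1 (torusGraph 2 M) (-1) Δ with hHdef
  have hWex : ∃ σ : TensorIndex (TorusSite 2 M) 2, (∑ z, (σ z : ℕ)) = W :=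
    exists_config_weight_eq 2 M W hWle
  obtain ⟨-, huniq⟩ :=
    xxz_sector_perronFrobenius (torusGraph 2 M) (torusGraph_connected 2 M) Δ W hWex
  rw [hsecR] at huniq
  -- the translated vector
  set π : TorusSite 2 M ≃ TorusSite 2 M := Equiv.addRight v with hπdef
  set ψ' : TensorIndex (TorusSite 2 M) 2 → ℂ := fun σ => ψ (σ ∘ π) with hψ'def
  -- (1) it lies in the sector
  have hwt : ∀ φ : TensorIndex (TorusSite 2 M) 2 → ℂ,
      φ ∈ @spinZSector (TorusSite 2 M) _ _ 1 0 ↔ ∀ σ, (∑ z, (σ z : ℕ)) ≠ W → φ σ = 0 := fun φ => by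
    rw [← hsecR]
    exact LiebMattis.mem_spinZSector_weight_iff 1 W φ
  have hψ' : ψ' ∈ @spinZSector (TorusSite 2 M) _ _ 1 0 := by
    rw [hwt]
    intro σ hσ
    exact (hwt ψ).1 hψ (σ ∘ π) (by rwa [weight_comp_equiv])
  -- (2) it satisfies the eigen-equation
  have hinv := xxzTorus_submatrix_comp_addRight M 1 (-1) Δ v
  have heig' : H *ᵥ ψ' =
      ((lowestEnergyInSector 1 H 0 : ℝ) : ℂ) • ψ' := by
    rw [hψ'def, mulVec_comp_of_submatrix_eq π hinv ψ]
    funext σ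
    rw [heig]
    rfl
  -- (3) hence it is a multiple of `ψ`, with a unimodular factor
  have hψ0 : ψ ≠ 0 := by
    rintro rfl
    rw [star_zero, zero_dotProduct] at hnorm
    exact zero_ne_one hnorm
  obtain ⟨c, hc⟩ := huniq ψ ψ' hψ hψ' heig heig' hψ0
  have hnorm' : star ψ' ⬝ᵥ ψ' = 1 := by rw [hψ'def, star_comp_dotProduct_comp π ψ ψ, hnorm]
  have hcc : star c * c = 1 := by
    rw [hc, star_smul, smul_dotProduct, dotProduct_smul, smul_smul, hnorm, smul_eq_mul,
      mul_one] at hnorm'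
    exact hnorm'
  -- (4) covariance of the observable
  set A : Op (TorusSite 2 M) 2 := onSite x (spinRaise 1) * onSite y (spinLower 1) with hAdef
  have hA : A.submatrix (fun σ => σ ∘ π) (fun σ => σ ∘ π) =
      onSite (x + v) (spinRaise 1) * onSite (y + v) (spinLower 1) := by
    rw [hAdef, Matrix.submatrix_mul _ _ _ _ _ (bijective_comp_equiv (q := 2) π),
      onSite_submatrix_comp, onSite_submatrix_comp]
    rfl
  calc star ψ ⬝ᵥ (onSite (x + v) (spinRaise 1) * onSite (y + v) (spinLower 1)) *ᵥ ψ
      = (star c * c) * (star ψ ⬝ᵥ (onSite (x + v) (spinRaise 1) * onSite (y + v) (spinLower 1)) *ᵥ ψ) := by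
        rw [hcc, one_mul]
    _ = star ψ' ⬝ᵥ (onSite (x + v) (spinRaise 1) * onSite (y + v) (spinLower 1)) *ᵥ ψ' := by
        rw [hc, mulVec_smul, star_smul, smul_dotProduct, dotProduct_smul, smul_smul, smul_eq_mul]
    _ = star ψ ⬝ᵥ A *ᵥ ψ := by rw [← hA, hψ'def, expect_submatrix_comp π A ψ]

/-- **Translation invariance of the real transverse kernel of a sector ground state**:
`Re ⟨ψ, S⁺_{x+v} S⁻_{y+v} ψ⟩ = Re ⟨ψ, S⁺_x S⁻_y ψ⟩` (real part of
`gs_expect_raiseLower_translate`). [folklore] -/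
theorem gs_transverseKernel_translate (hEven : Even M) (Δ : ℝ)
    (ψ : TensorIndex (TorusSite 2 M) 2 → ℂ)
    (hψ : ψ ∈ @spinZSector (TorusSite 2 M) _ _ 1 0) (hnorm : star ψ ⬝ᵥ ψ = 1)
    (heig : Matrix.mulVec (xxzHamiltonian 1 (torusGraph 2 M) (-1) Δ) ψ =
      ((lowestEnergyInSector 1 (xxzHamiltonian 1 (torusGraph 2 M) (-1) Δ) 0 : ℝ) : ℂ) • ψ)
    (v x y : TorusSite 2 M) :
    (star ψ ⬝ᵥ (onSite (x + v) (spinRaise 1) * onSite (y + v) (spinLower 1)) *ᵥ ψ).re =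
      (star ψ ⬝ᵥ (onSite x (spinRaise 1) * onSite y (spinLower 1)) *ᵥ ψ).re := by
  rw [gs_expect_raiseLower_translate M hEven Δ ψ hψ hnorm heig v x y]

/-- **The real transverse kernel of a sector ground state is a symmetric function of the
difference**: `Re ⟨ψ, S⁺_x S⁻_y ψ⟩ = Re ⟨ψ, S⁺_{x-y} S⁻_0 ψ⟩` and
`Re ⟨ψ, S⁺_{-z} S⁻_0 ψ⟩ = Re ⟨ψ, S⁺_z S⁻_0 ψ⟩`. [folklore] -/
theorem gs_transverseKernel_eq_sub (hEven : Even M) (Δ : ℝ)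
    (ψ : TensorIndex (TorusSite 2 M) 2 → ℂ)
    (hψ : ψ ∈ @spinZSector (TorusSite 2 M) _ _ 1 0) (hnorm : star ψ ⬝ᵥ ψ = 1)
    (heig : Matrix.mulVec (xxzHamiltonian 1 (torusGraph 2 M) (-1) Δ) ψ =
      ((lowestEnergyInSector 1 (xxzHamiltonian 1 (torusGraph 2 M) (-1) Δ) 0 : ℝ) : ℂ) • ψ)
    (x y : TorusSite 2 M) :
    (star ψ ⬝ᵥ (onSite x (spinRaise 1) * onSite y (spinLower 1)) *ᵥ ψ).re =
      (star ψ ⬝ᵥ (onSite (x - y) (spinRaise 1) * onSite 0 (spinLower 1)) *ᵥ ψ).re := by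
  have h := gs_transverseKernel_translate M hEven Δ ψ hψ hnorm heig (-y) x y
  rw [add_neg_cancel, ← sub_eq_add_neg] at h
  exact h.symm

/-- Evenness of the difference kernel of a sector ground state:
`Re ⟨ψ, S⁺_{-z} S⁻_0 ψ⟩ = Re ⟨ψ, S⁺_z S⁻_0 ψ⟩` (symmetry + translation by `z`). [folklore] -/
theorem gs_transverseKernel_neg (hEven : Even M) (Δ : ℝ)
    (ψ : TensorIndex (TorusSite 2 M) 2 → ℂ)
    (hψ : ψ ∈ @spinZSector (TorusSite 2 M) _ _ 1 0) (hnorm : star ψ ⬝ᵥ ψ = 1)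
    (heig : Matrix.mulVec (xxzHamiltonian 1 (torusGraph 2 M) (-1) Δ) ψ =
      ((lowestEnergyInSector 1 (xxzHamiltonian 1 (torusGraph 2 M) (-1) Δ) 0 : ℝ) : ℂ) • ψ)
    (z : TorusSite 2 M) :
    (star ψ ⬝ᵥ (onSite (-z) (spinRaise 1) * onSite 0 (spinLower 1)) *ᵥ ψ).re =
      (star ψ ⬝ᵥ (onSite z (spinRaise 1) * onSite 0 (spinLower 1)) *ᵥ ψ).re := by
  rw [re_expect_raiseLower_symm 1 ψ (-z) 0,
    gs_transverseKernel_eq_sub M hEven Δ ψ hψ hnorm heig 0 (-z), zero_sub, neg_neg]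

end Torus

/-- **Registered sub-goal `stub_gsKernelTranslate` of crux `Block2InfDivXXZ`** (translation
covariance of the sector ground-state transverse expectations, the `∀`-closed form of
`gs_expect_raiseLower_translate`): for even `M`, every real `Δ` and every normalised `S^z_tot = 0`
sector ground state `ψ` of `xxzHamiltonian 1 (torusGraph 2 M) (-1) Δ`,
`⟨ψ, S⁺_{x+v} S⁻_{y+v} ψ⟩ = ⟨ψ, S⁺_x S⁻_y ψ⟩` for all `v x y`. Perron–Frobenius uniqueness in the
sector + covariance of local operators. Tasaki (2020) §2.1, §2.4. [folklore] -/
theorem stub_gsKernelTranslate :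
    ∀ (M : ℕ) [NeZero M], Even M → ∀ (Δ : ℝ) (ψ : TensorIndex (TorusSite 2 M) 2 → ℂ),
      ψ ∈ @spinZSector (TorusSite 2 M) _ _ 1 0 → star ψ ⬝ᵥ ψ = 1 →
      Matrix.mulVec (xxzHamiltonian 1 (torusGraph 2 M) (-1) Δ) ψ =
        ((lowestEnergyInSector 1 (xxzHamiltonian 1 (torusGraph 2 M) (-1) Δ) 0 : ℝ) : ℂ) • ψ →
      ∀ v x y : TorusSite 2 M,
        star ψ ⬝ᵥ Matrix.mulVec (onSite (x + v) (spinRaise 1) * onSite (y + v) (spinLower 1)) ψ =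
          star ψ ⬝ᵥ Matrix.mulVec (onSite x (spinRaise 1) * onSite y (spinLower 1)) ψ :=
  fun M _ hEven Δ ψ hψ hnorm heig v x y =>
    gs_expect_raiseLower_translate M hEven Δ ψ hψ hnorm heig v x y

end Summit.HubbardSuperconductivity.HubbardSuperconductivity.Theorems.LevyLogBootstrap

end
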